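import Mathlib
import Literature.MathematicalPhysics.QuantumFieldTheory.Balaban1983to89.B9

/-!
# T4EtaRate — the η-rate HYPOTHESIS SHAPE for Bałaban's background propagators (cell `pub-balaban`, T4-DAG v1 node U1, row T4-U1a.E "NE2 BACKGROUND LAYER"; typing + bookkeeping only)

HONEST FRAMING (T4-DAG v1 PAGE 1).  The cell's T4 target is rung (B)+1: existence AND uniqueness of the ε → 0 limit of
Bałaban's unit-scale averaged expectations on a FIXED finite torus — strictly beyond ultraviolet stability
([Balaban1989LargeFieldII] Thm 1 p. 355), and NOT infinite volume, NOT a mass gap, NOT the Clay problem.  Node U1 of that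
spine needs, for every linear one-step object X built at lattice spacing η = L^{−k} (run A) and at η′ = L^{−n}η (run B), an
η-DIFFERENCE estimate with a geometric rate.  NO SUCH ESTIMATE IS PRINTED in [Balaban1983RegularityDecay],
[Balaban1984PropagatorsI], [Balaban1984PropagatorsII], [Balaban1985BackgroundPropagators] (cell record `t4/T4-XREAD-U1a.md` §3:
every printed constant there is "independent of the lattice spacing η" / "dependent on d and L only" — UNIFORMITY, never a
difference), and the only printed η-rates for block renormalization-group propagators are C. King's, for the U(1) Higgs
model in d = 2, 3 at background A = 0 ([King1986] Props 3.8–3.10, Lemmas 4.3–4.5).  Accordingly this module ASSERTS NOTHING: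
every `def … : Prop` below is a HYPOTHESIS SHAPE (a predicate over the abstract carriers of `B9.lean`, to be ASSUMED by the
spine's nodes U3/U6, never used as a fact), and every `theorem` is kernel-checked bookkeeping about the shape (scale algebra of
the rate factor, composition of pairings, specialisation to the trivial background).  The estimate that would instantiate
the shapes — the cell's located NEW ESTIMATE NE2 (background layer NE2⁺ and its A = 0 layer NE2⁰) — is NOT in print and is,
in this seat's judgement, BEYOND KERNEL REACH at present (it needs the whole of B6/B9's random-walk machinery at two lattice
spacings simultaneously); its paper-level proof sketch with every printed input cited by page is the cell record
`t4/T4-EST-U1a.md`.  Value = a typed hypothesis shape with exact quantifiers + a precise list of the UNPRINTED CONVENTIONS the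
statement must fix; NOT summit progress.

## What is typed, and after which printed template

(1) THE PAIRING (§1, `EtaPairing`) — NOT PRINTED in the audited series (cell GAPS G-t4-U1a-2).  To compare an object built on
T_η (k scales, regions Ω₀ ⊃ … ⊃ Ω_k, coarse sites 𝔅 = ⋃_j Λ_j) with the object built on T_η′ (k + n scales) one must FIX: (i) an
embedding ι of the coarse sites of run A into those of run B shifting the scale index by n (a site y ∈ Λ_j of run A, block size
L^jη, corresponds to a site of run B of scale index j + n and the SAME physical size L^{j+n}η′ = L^jη — `EtaPairing.len_ι`); (ii) a
transport τ of test functions λ from T_η to T_η′; (iii) a transport of background fields from the fine lattice to the coarse one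
(the n-fold average of [Balaban1985Averaging]).  The one printed convention of this kind is King's, for lattice POINTS (verbatim,
[King1986] p. 664): *"When x′ ∈ T_{η′}, we denote by x that point in T_η for which x′ ∈ B^n(x)."*  Here (i)–(iii) are DATA of the
statement (structure fields with bookkeeping axioms only); no existence or canonicity is claimed, and two admissible pairings give two
different (both meaningful) instances of the hypothesis shape.

(2) THE DIFFERENCE FAMILY AND ITS INEQUALITIES (§3) — typed on the template PRINTED in the audited paper itself for DOMAIN
differences, [Balaban1985BackgroundPropagators] Thm 3.14 pp. 426–427 (verbatim): *"If we take a pair of operators constructed for the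
two sequences {Ω_j}, {Ω′_j}, then their difference satisfies all the inequalities characteristic for operators of the considered type,
with the additional factor exp(−δ₀d(y, y′, Ω)) … on the right-hand sides"* (tree `B9.Thm314Printed`: the difference operator seen
through the same sup quantities `KernelFamily.e`, times an additional factor).  NE2 is typed IDENTICALLY with "two sequences of
domains" replaced by "two lattice spacings η, η′ under a pairing" and the additional factor replaced by the RATE FACTOR of (3).

(3) THE RATE FACTOR (§2, `rateFactor g γ y = (η / L^jη)^γ` for y ∈ Λ_j) — the scale-covariant rewriting of the factor PRINTED by
King ([King1986] Prop. 3.9 (3.73) p. 665, verbatim): *"|G^{η′}_{(j)}(x′, y′) − G^η_{(j)}(x, y)|, |∂^{η′}_μG^{η′}_{(j)}(x′, y′) −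
∂^η_μG^η_{(j)}(x, y)| ≤ CL^{−γk}{(L^jη)^{2−d−γ}, (L^jη)^{1−d−γ}} exp[−δ₀(L^jη)^{−1}|x − y|]"* — i.e. the uniform majorant of the
scale-j piece times L^{−γk}(L^jη)^{−γ}; since η = L^{−k}, L^{−γk}(L^jη)^{−γ} = (η/(L^jη))^γ = L^{−γj} (`rateFactor_eq_king`): the
discrepancy between the η- and η′-objects seen at a site of physical size L^jη is (lattice spacing / size)^γ — of order one at the
finest scale and equal to η^γ = θ^k, θ = L^{−γ}, at the unit scale L^jη = 1 (`rateFactor_unit`, `eta_rpow_eq_theta_pow`), which is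
the geometric rate the spine's Cauchy sum consumes (tree `T4CauchySum.GeomRate`; King's own unit-lattice instances: (3.91) with
L^{−2k}, (4.38) with L^{−k}).  DESIGN CHOICE [this cell, not printed]: for a two-site kernel bound (y ∈ Λ_j, y′ ∈ Λ_{j′}) the shape
carries the LARGER of the two factors, `max (rateFactor y) (rateFactor y′)` (the finer site governs) — the weakest form that still
yields θ^k when both sites are at the unit scale (cell GAPS G-t4-U1a-3).

(4) THE LAYERS.  NE2⁺ OPERATOR LAYER `NE2PlusOperator` (the propagators G′(U), G(U) of Thms 3.1/3.3 and the Sect. D propagators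
G, G₁, 𝔊 of Thms 3.12–3.13, through the four sup entries of (3.42) p. 397); NE2⁺ SITE-KERNEL LAYER `NE2PlusSite` (the kernels on 𝔅:
(Q′G′²Q′*)^{−1} (3.48) p. 398 with (L^jη)^{−4}, (QGQ*)^{−1} (3.132) p. 422 with (L^jη)^{−2}, the sup entries of H (3.133) p. 422);
NE2⁺ UNIT-LATTICE LAYER `NE2PlusUnit` (the unit-lattice covariance C^{(k)}(Λ) of Thm 3.15 (3.187) p. 432 — the object the
spine's node U3 consumes, King's C^{(k)} of (2.16)/(4.38)); and the A = 0 layer NE2⁰ = the same shapes at the trivial background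
(`NE2ZeroOperator`, `ne2Zero_of_ne2Plus`).  The Hölder entries (3.43)–(3.45), the L² entries (3.46) and the global entries (3.47) are
NOT given an η-rate shape here (none is needed downstream; adding them is mechanical).

(5) BACKGROUND PAIRS [analysis, for node U3].  The spine compares X(U_A) on T_η with X(U_B) on T_η′ where U_A, U_B are the two runs'
background fields (both functions of the same unit-lattice data V, [Balaban1985UVStabilityThree] (2.18)); they are NOT an η-pair in
the sense of (1)(iii).  The intended use is the split  X^{η′}(U_B) − X^{η}(U_A) = [X^{η′}(U_B) − X^{η}(avgⁿ U_B)] + [X^{η}(avgⁿ U_B) −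
X^{η}(U_A)]: the first bracket is NE2⁺ as typed here; the second is background-Lipschitz continuity AT FIXED η, which follows from the
PRINTED analyticity [Balaban1985BackgroundPropagators] Thm 3.4 p. 400 (*"the operators G′(U), (Q′(U)G′²(U)Q′*(U))^{−1}, R(U), G(U)
extend to configurations U′U for α₁ ≤ a₁ as analytic functions of A. The extended operators satisfy all the inequalities of Theorems
3.1–3.3 correspondingly"*, tree `B9.Thm34Printed`) by a Cauchy estimate, times the closeness |avgⁿ U_B − U_A| which is the cell's NE3
(node U1b).  Nothing of (5) is typed here beyond this sentence.

GAPS (cell `GAPS.md`): G-t4-U1a-1 (located absence of any printed η-difference statement in B4–B6, B9), G-t4-U1a-2 (the three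
transports (i)–(iii) are unprinted conventions — typed as DATA), G-t4-U1a-3 (which site's rate factor — the `max` choice), and the
standing framing that NE2 itself is a NEW estimate beyond kernel reach (T4-DAG v1 §6).
-/

namespace Literature.MathematicalPhysics.QuantumFieldTheory.Balaban1983to89.T4EtaRate

open Literature.MathematicalPhysics.QuantumFieldTheory.Balaban1983to89.B9

/-! ## §1 The η-pairing (NOT PRINTED — data of the statement, cell GAPS G-t4-U1a-2) -/

/-- The PAIRING DATA between a coarse instance (geometry `gc` on T_η with k scales, backgrounds `Bc`) and a fine instance
(`gf` on T_η′, η′ = L^{−n}η, k + n scales, backgrounds `Bf`): the scale shift `n`; the coarse-site embedding `ι` (a site of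
Λ_j in run A ↦ the site of scale index j + n and the same physical size in run B), preserving the scaled distance d(y, y′); the
test-function transport `τ` (support- and sup-norm-compatible); the background transport `avg` (fine ↦ coarse, the n-fold
average, sending U ≡ 1 to U ≡ 1).  Bookkeeping axioms only; NOT PRINTED (the one printed convention of this kind is for lattice
points: *"When x′ ∈ T_{η′}, we denote by x that point in T_η for which x′ ∈ B^n(x)"*).  No existence or canonicity is asserted. [cite: King1986, p.664 (convention before Prop. 3.8)] -/
structure EtaPairing (gc gf : Geometry) (Bc Bf : Backgrounds) where
  n : ℕ
  k_eq : gf.k = gc.k + n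
  L_eq : gf.L = gc.L
  M_eq : gf.M = gc.M
  eta_eq : gf.eta * gf.L ^ n = gc.eta
  ι : gc.Site → gf.Site
  scale_ι : ∀ y : gc.Site, gf.scale (ι y) = gc.scale y + n
  dist_ι : ∀ y y' : gc.Site, gf.dist (ι y) (ι y') = gc.dist y y'
  τ : gc.Loc → gf.Loc
  suppIn_τ : ∀ (lam : gc.Loc) (y : gc.Site), gc.suppIn lam y → gf.suppIn (τ lam) (ι y)
  supNorm_τ : ∀ lam : gc.Loc, gf.supNorm (τ lam) ≤ gc.supNorm lam
  avg : Bf.Cfg → Bc.Cfg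
  avg_one : avg Bf.one = Bc.one

namespace EtaPairing

variable {gc gf gh : Geometry} {Bc Bf Bh : Backgrounds}

/-- Bookkeeping: the embedded site has the SAME physical size, L^{j+n}η′ = L^jη. [folklore] -/
theorem len_ι (P : EtaPairing gc gf Bc Bf) (y : gc.Site) : gf.len (P.ι y) = gc.len y := by
  unfold Geometry.len
  rw [P.scale_ι, pow_add, ← P.eta_eq, P.L_eq]
  ring

/-- Pairings COMPOSE (n-step from one-steps): the convention needed to telescope one-step η-rates into the spine's Cauchy
sum (node U6).  Scale shifts add; embeddings, transports and averages compose. [folklore] -/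
def comp (P : EtaPairing gc gf Bc Bf) (Q : EtaPairing gf gh Bf Bh) : EtaPairing gc gh Bc Bh where
  n := P.n + Q.n
  k_eq := by rw [Q.k_eq, P.k_eq, Nat.add_assoc]
  L_eq := by rw [Q.L_eq, P.L_eq]
  M_eq := by rw [Q.M_eq, P.M_eq]
  eta_eq := by
    rw [← P.eta_eq, ← Q.eta_eq, Q.L_eq, pow_add]
    ring
  ι := Q.ι ∘ P.ι
  scale_ι := fun y => by
    show gh.scale (Q.ι (P.ι y)) = gc.scale y + (P.n + Q.n)
    rw [Q.scale_ι, P.scale_ι, Nat.add_assoc]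
  dist_ι := fun y y' => by
    show gh.dist (Q.ι (P.ι y)) (Q.ι (P.ι y')) = gc.dist y y'
    rw [Q.dist_ι, P.dist_ι]
  τ := Q.τ ∘ P.τ
  suppIn_τ := fun lam y h => Q.suppIn_τ (P.τ lam) (P.ι y) (P.suppIn_τ lam y h)
  supNorm_τ := fun lam => (Q.supNorm_τ (P.τ lam)).trans (P.supNorm_τ lam)
  avg := P.avg ∘ Q.avg
  avg_one := by
    show P.avg (Q.avg Bh.one) = Bc.one
    rw [Q.avg_one, P.avg_one]

/-- The scale shift of a composite pairing is the sum of the shifts. [folklore] -/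
@[simp] theorem comp_n (P : EtaPairing gc gf Bc Bf) (Q : EtaPairing gf gh Bf Bh) : (P.comp Q).n = P.n + Q.n := rfl

end EtaPairing

/-- A PAIRED INSTANCE: the two instances and the pairing, packaged so that a family of η-difference estimates can be indexed
(as B9's printed theorems are) by an abstract instance type `I`.  The η-difference family of an instance is a `KernelFamily`
over the COARSE geometry and the FINE backgrounds: its entries are evaluated at a fine configuration U′, a coarse test
function λ (transported by τ) and a coarse observation site y (embedded by ι) — e.g. entry n = 0 is INTENDED to be
sup_{x′ ∈ Δ(ι y)} |(G^{η′}(U′) τλ)(x′) − (G^{η}(avg U′) λ)(x)| with x′ ∈ B^n(x); the intention is documentation, the carrier is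
abstract (as everywhere in `B9.lean`). [cite: Balaban1985BackgroundPropagators, Thm 3.14 pp.426–427 (typing template)] -/
structure PairedInstance where
  gc : Geometry
  gf : Geometry
  Bc : Backgrounds
  Bf : Backgrounds
  pair : EtaPairing gc gf Bc Bf

/-! ## §2 The rate factor (η / L^jη)^γ — King's printed L^{−γk}(L^jη)^{−γ}, rewritten scale-covariantly -/

/-- The RATE FACTOR at a coarse site y ∈ Λ_j: (η / L^jη)^γ = (lattice spacing / physical size of the site)^γ. [cite: King1986, Prop. 3.9 (3.73) p.665] -/
noncomputable def rateFactor (g : Geometry) (γ : ℝ) (y : g.Site) : ℝ := (g.eta / g.len y) ^ γ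

variable {g : Geometry} {B : Backgrounds}

/-- The rate factor is nonnegative (η ≥ 0, L ≥ 0). [folklore] -/
theorem rateFactor_nonneg (hη : 0 ≤ g.eta) (hL : 0 ≤ g.L) (γ : ℝ) (y : g.Site) : 0 ≤ rateFactor g γ y := by
  unfold rateFactor Geometry.len
  exact Real.rpow_nonneg (div_nonneg hη (mul_nonneg (pow_nonneg hL _) hη)) γ

/-- (η / L^jη)^γ = (L^j)^{−γ} (η ≠ 0). [folklore] -/
theorem rateFactor_eq_rpow_scale (hη : g.eta ≠ 0) (hL : 0 < g.L) (γ : ℝ) (y : g.Site) :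
    rateFactor g γ y = (g.L ^ g.scale y) ^ (-γ) := by
  unfold rateFactor Geometry.len
  have hpow : (0 : ℝ) < g.L ^ g.scale y := pow_pos hL _
  have hpow' : g.L ^ g.scale y ≠ 0 := hpow.ne'
  rw [show g.eta / (g.L ^ g.scale y * g.eta) = (g.L ^ g.scale y)⁻¹ by field_simp]
  rw [Real.inv_rpow hpow.le, Real.rpow_neg hpow.le]

/-- KING'S PRINTED FORM: with η = L^{−k}, L^{−γk}·(L^jη)^{−γ} = (η / L^jη)^γ — the factor of (3.73)/(3.75) IS the rate factor. [cite: King1986, Prop. 3.9 (3.73) p.665] -/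
theorem rateFactor_eq_king (hη : g.eta = (g.L ^ g.k)⁻¹) (hL : 0 < g.L) (γ : ℝ) (y : g.Site) :
    rateFactor g γ y = (g.L ^ g.k) ^ (-γ) * (g.len y) ^ (-γ) := by
  have hk : (0 : ℝ) < g.L ^ g.k := pow_pos hL _
  have hj : (0 : ℝ) < g.L ^ g.scale y := pow_pos hL _
  have hη0 : g.eta ≠ 0 := by rw [hη]; exact inv_ne_zero hk.ne'
  rw [rateFactor_eq_rpow_scale hη0 hL, Geometry.len, ← Real.mul_rpow hk.le (mul_nonneg hj.le (by rw [hη]; exact inv_nonneg.mpr hk.le))]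
  congr 1
  rw [hη, ← mul_assoc, mul_comm (g.L ^ g.k), mul_assoc, mul_inv_cancel₀ hk.ne', mul_one]

/-- At the UNIT scale (L^jη = 1) the rate factor is η^γ. [folklore] -/
theorem rateFactor_unit (γ : ℝ) {y : g.Site} (hy : g.len y = 1) : rateFactor g γ y = g.eta ^ γ := by
  unfold rateFactor
  rw [hy, div_one]

/-- … and η^γ = θ^k with θ = L^{−γ}: the GEOMETRIC RATE the spine's Cauchy sum consumes (`T4CauchySum.GeomRate`). [folklore] -/
theorem eta_rpow_eq_theta_pow (hη : g.eta = (g.L ^ g.k)⁻¹) (hL : 0 < g.L) (γ : ℝ) :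
    g.eta ^ γ = (g.L ^ (-γ)) ^ g.k := by
  have hk : (0 : ℝ) ≤ g.L ^ g.k := (pow_pos hL _).le
  rw [hη, Real.inv_rpow hk, ← Real.rpow_neg hk, ← Real.rpow_natCast g.L g.k, ← Real.rpow_mul hL.le,
    mul_comm, Real.rpow_mul hL.le, Real.rpow_natCast]

/-- The rate factor is ≤ 1 at every site not finer than the lattice spacing (η ≤ L^jη, γ ≥ 0). [folklore] -/
theorem rateFactor_le_one (hη : 0 < g.eta) {γ : ℝ} (hγ : 0 ≤ γ) {y : g.Site} (hy : g.eta ≤ g.len y) :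
    rateFactor g γ y ≤ 1 := by
  unfold rateFactor
  have hlen : 0 < g.len y := lt_of_lt_of_le hη hy
  exact Real.rpow_le_one (div_nonneg hη.le hlen.le) ((div_le_one hlen).mpr hy) hγ

/-- A CLEAN geometric rate θ^k, θ = L^{−γ}, is the STRONGER statement: θ^k = η^γ ≤ (η / L^jη)^γ at every site of physical
size ≤ 1 (all of B9's sites: L^jη ≤ L^kη = 1).  Hence an estimate with the clean factor θ^k implies the King-shaped one. [folklore] -/
theorem theta_pow_le_rateFactor (hη : g.eta = (g.L ^ g.k)⁻¹) (hL : 1 < g.L) {γ : ℝ} (hγ : 0 ≤ γ) {y : g.Site}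
    (hy0 : 0 < g.len y) (hy1 : g.len y ≤ 1) : (g.L ^ (-γ)) ^ g.k ≤ rateFactor g γ y := by
  have hL0 : 0 < g.L := lt_trans zero_lt_one hL
  have hηpos : 0 < g.eta := by rw [hη]; exact inv_pos.mpr (pow_pos hL0 _)
  rw [← eta_rpow_eq_theta_pow hη hL0 γ, rateFactor]
  refine Real.rpow_le_rpow hηpos.le ?_ hγ
  rw [le_div_iff₀ hy0]
  calc g.eta * g.len y ≤ g.eta * 1 := mul_le_mul_of_nonneg_left hy1 hηpos.le
    _ = g.eta := mul_one _

/-! ## §3 The η-difference inequalities — B9 Thm 3.14's pattern with the rate factor (HYPOTHESIS SHAPES, not printed) -/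

/-- NE2⁺ OPERATOR LAYER at one fine configuration U: the η-difference family `Kd` (coarse geometry, fine backgrounds)
satisfies the four sup entries of (3.42) with constants (B₀, δ₀) AND the additional factor
max((η/L^jη)^γ, (η/L^{j′}η)^γ) (observation site y ∈ Λ_j, source site y′ ∈ Λ_{j′}).  HYPOTHESIS SHAPE — NOT PRINTED; typed on
the printed template of Thm 3.14 (domain differences) with King's printed rate factor. [cite: Balaban1985BackgroundPropagators, (3.42) p.397 + Thm 3.14 pp.426–427 (template)] -/
def EtaRateIneq342 (Kd : KernelFamily g B) (B₀ δ₀ γ : ℝ) (U : B.Cfg) : Prop :=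
  ∀ (n : Fin 4) (lam : g.Loc) (y y' : g.Site), g.suppIn lam y' →
    Kd.e n U lam y ≤ B₀ * pref4 (g.len y) n * Real.exp (-(δ₀ * g.dist y y')) *
      max (rateFactor g γ y) (rateFactor g γ y') * g.supNorm lam

/-- NE2⁺ SITE-KERNEL LAYER at one U, exponent p and decay rate δ: |Kd(y, y′)| ≤ C(L^jη)^{−p}(L^{j′}η)^{−d}e^{−δd(y,y′)} ×
max-rate-factor — p = 4, δ = δ₀ for the η-difference of (Q′G′²Q′*)^{−1} (3.48); p = 2, δ = δ₁ for (QGQ*)^{−1} (3.132); p ∈ {0, 1},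
δ = ½δ₁ for the sup entries of the H-kernel (3.133).  HYPOTHESIS SHAPE — NOT PRINTED. [cite: Balaban1985BackgroundPropagators, (3.48) p.398 + (3.132)–(3.133) p.422 (majorants)] -/
def EtaRateIneqSite (d : ℕ) (p : ℝ) (Kd : SiteKernel g B) (C δ γ : ℝ) (U : B.Cfg) : Prop :=
  ∀ y y' : g.Site, |Kd.ker U y y'| ≤ C * (g.len y) ^ (-p) * (g.len y') ^ (-(d : ℝ)) *
    Real.exp (-(δ * g.dist y y')) * max (rateFactor g γ y) (rateFactor g γ y')

/-- NE2⁺ UNIT-LATTICE LAYER at one U: the η-difference of the unit-lattice covariance C^{(k)}(Λ) of (3.185)–(3.187) obeys the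
printed majorant B₀e^{−δ₀|y−y′|} times the CLEAN geometric factor θ^k (k = the number of scales of the coarse run; at the unit
scale the rate factor IS θ^k, `rateFactor_unit` + `eta_rpow_eq_theta_pow`).  This is the form node U3 consumes; King's
printed A = 0 instance is Lemma 4.5 (4.38) with θ = L^{−1}: *"|C^{(k)}(x, y) − C^{(k+n)}(x, y)| ≤ CL^{−k}e^{−δ₀|x−y|}"*.
HYPOTHESIS SHAPE — NOT PRINTED for Bałaban's C^{(k)}(Λ). [cite: Balaban1985BackgroundPropagators, Thm 3.15 (3.187) p.432 (majorant); King1986, Lemma 4.5 (4.38) p.674 (A = 0 template)] -/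
def EtaRateIneqUnit (Kd : SiteKernel g B) (inΛ : g.Site → Prop) (unitDist : g.Site → g.Site → ℝ)
    (B₀ δ₀ θ : ℝ) (k : ℕ) (U : B.Cfg) : Prop :=
  ∀ y y' : g.Site, inΛ y → inΛ y' → |Kd.ker U y y'| ≤ B₀ * Real.exp (-(δ₀ * unitDist y y')) * θ ^ k

/-- **NE2⁺, operator layer** (HYPOTHESIS SHAPE, NOT PRINTED): there are constants M₅, δ₀, a₀, B₀ > 0 and a rate exponent
γ > 0, uniform in the paired instance (hence in k, n, the regions and the background), such that for M ≥ M₅, Mα₀ ≤ a₀ and every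
fine configuration U satisfying the regularity condition (3.35), the η-difference family obeys `EtaRateIneq342`.  Quantifier
block copied from the printed Thm 3.1/3.14 (tree `B9.Thm31Printed`, `B9.Thm314Printed`). [cite: Balaban1985BackgroundPropagators, Thm 3.1 p.397 + Thm 3.14 pp.426–427 (quantifier template)] -/
def NE2PlusOperator {I : Type} (c35 : ℝ) (pi : I → PairedInstance)
    (Kd : ∀ i, KernelFamily (pi i).gc (pi i).Bf) : Prop :=
  ∃ M₅ δ₀ a₀ B₀ γ : ℝ, 0 < M₅ ∧ 0 < δ₀ ∧ 0 < a₀ ∧ 0 < B₀ ∧ 0 < γ ∧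
    ∀ i : I, M₅ ≤ (pi i).gf.M → ∀ α₀ : ℝ, 0 < α₀ → (pi i).gf.M * α₀ ≤ a₀ →
      ∀ U : (pi i).Bf.Cfg, (pi i).Bf.Reg335 c35 α₀ U → EtaRateIneq342 (Kd i) B₀ δ₀ γ U

/-- **NE2⁺, site-kernel layer** (HYPOTHESIS SHAPE, NOT PRINTED), for a kernel of exponent p and the instance's dimension d. [cite: Balaban1985BackgroundPropagators, Thm 3.2 (3.48) p.398 + (3.132) p.422 (majorants)] -/
def NE2PlusSite {I : Type} (d : ℕ) (p : ℝ) (c35 : ℝ) (pi : I → PairedInstance)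
    (Kd : ∀ i, SiteKernel (pi i).gc (pi i).Bf) : Prop :=
  ∃ M₅ δ a₀ C γ : ℝ, 0 < M₅ ∧ 0 < δ ∧ 0 < a₀ ∧ 0 < C ∧ 0 < γ ∧
    ∀ i : I, M₅ ≤ (pi i).gf.M → ∀ α₀ : ℝ, 0 < α₀ → (pi i).gf.M * α₀ ≤ a₀ →
      ∀ U : (pi i).Bf.Cfg, (pi i).Bf.Reg335 c35 α₀ U → EtaRateIneqSite d p (Kd i) C δ γ U

/-- **NE2⁺, unit-lattice layer** (HYPOTHESIS SHAPE, NOT PRINTED): the η-difference of C^{(k)}(Λ) with a clean rate θ ∈ (0, 1),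
uniform constants, under both regularity conditions (3.35)–(3.36) (as in the printed Thm 3.15). [cite: Balaban1985BackgroundPropagators, Thm 3.15 (3.187) p.432 (quantifier template)] -/
def NE2PlusUnit {I : Type} (c35 : ℝ) (pi : I → PairedInstance) (Kd : ∀ i, SiteKernel (pi i).gc (pi i).Bf)
    (inΛ : ∀ i, (pi i).gc.Site → Prop) (unitDist : ∀ i, (pi i).gc.Site → (pi i).gc.Site → ℝ) : Prop :=
  ∃ δ₀ a₀ B₀ θ : ℝ, 0 < δ₀ ∧ 0 < a₀ ∧ 0 < B₀ ∧ 0 < θ ∧ θ < 1 ∧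
    ∀ i : I, ∀ α₀ : ℝ, 0 < α₀ → (pi i).gf.M * α₀ ≤ a₀ →
      ∀ U : (pi i).Bf.Cfg, (pi i).Bf.Reg335 c35 α₀ U → (pi i).Bf.Reg336 c35 α₀ U →
        EtaRateIneqUnit (Kd i) (inΛ i) (unitDist i) B₀ δ₀ θ (pi i).gc.k U

/-- **NE2⁰, operator layer** (HYPOTHESIS SHAPE): the same inequalities at the TRIVIAL background U ≡ 1 only (A = 0 — the layer
for which King's d = 2, 3 scalar estimates are the printed model; for Bałaban's Landau-gauge vector propagators of B5/B6 it is
NOT printed either, cell record `t4/T4-XREAD-U1a.md` §4 X8–X12). [cite: King1986, Props. 3.8–3.9 (3.71)–(3.75) pp.664–665 (A = 0 model)] -/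
def NE2ZeroOperator {I : Type} (pi : I → PairedInstance) (Kd : ∀ i, KernelFamily (pi i).gc (pi i).Bf) : Prop :=
  ∃ M₅ δ₀ B₀ γ : ℝ, 0 < M₅ ∧ 0 < δ₀ ∧ 0 < B₀ ∧ 0 < γ ∧
    ∀ i : I, M₅ ≤ (pi i).gf.M → EtaRateIneq342 (Kd i) B₀ δ₀ γ (pi i).Bf.one

/-- Bookkeeping (kernel-checked): NE2⁺ implies NE2⁰, given that the trivial configuration is regular for every α₀ > 0 (A = 0
satisfies (3.35) — a property every instantiation of the abstract predicate `Reg335` must have; here a hypothesis). [folklore] -/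
theorem ne2Zero_of_ne2Plus {I : Type} {c35 : ℝ} {pi : I → PairedInstance} {Kd : ∀ i, KernelFamily (pi i).gc (pi i).Bf}
    (hreg : ∀ (i : I) (α₀ : ℝ), 0 < α₀ → (pi i).Bf.Reg335 c35 α₀ (pi i).Bf.one)
    (h : NE2PlusOperator c35 pi Kd) : NE2ZeroOperator pi Kd := by
  obtain ⟨M₅, δ₀, a₀, B₀, γ, hM, hδ, ha, hB, hγ, H⟩ := h
  refine ⟨M₅, δ₀, B₀, γ, hM, hδ, hB, hγ, fun i hMi => ?_⟩
  have hMpos : 0 < (pi i).gf.M := lt_of_lt_of_le hM hMi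
  have hα : 0 < a₀ / (pi i).gf.M := div_pos ha hMpos
  have hMne : (pi i).gf.M ≠ 0 := hMpos.ne'
  have hMa : (pi i).gf.M * (a₀ / (pi i).gf.M) = a₀ := by field_simp
  exact H i hMi (a₀ / (pi i).gf.M) hα hMa.le _ (hreg i _ hα)

/-- Bookkeeping (kernel-checked): a CLEAN operator-layer estimate (factor θ^k with θ = L^{−γ}, k = the coarse run's number of
scales) implies the King-shaped one, on instances whose sites all have physical size in (0, 1] and η = L^{−k}, L > 1, provided
the uniform constant B₀ and the entries' prefactors are nonnegative where needed. [folklore] -/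
theorem etaRateIneq342_of_clean {Kd : KernelFamily g B} {B₀ δ₀ γ : ℝ} {U : B.Cfg}
    (hη : g.eta = (g.L ^ g.k)⁻¹) (hL : 1 < g.L) (hγ : 0 ≤ γ) (hB : 0 ≤ B₀)
    (hlen : ∀ y : g.Site, 0 < g.len y ∧ g.len y ≤ 1) (hnorm : ∀ lam : g.Loc, 0 ≤ g.supNorm lam)
    (h : ∀ (n : Fin 4) (lam : g.Loc) (y y' : g.Site), g.suppIn lam y' →
      Kd.e n U lam y ≤ B₀ * pref4 (g.len y) n * Real.exp (-(δ₀ * g.dist y y')) *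
        (g.L ^ (-γ)) ^ g.k * g.supNorm lam) :
    EtaRateIneq342 Kd B₀ δ₀ γ U := by
  intro n lam y y' hsupp
  refine (h n lam y y' hsupp).trans ?_
  have hpref : 0 ≤ pref4 (g.len y) n := by
    have h0 := (hlen y).1.le
    fin_cases n <;> simp [pref4] <;> nlinarith [h0]
  have hfac : (g.L ^ (-γ)) ^ g.k ≤ max (rateFactor g γ y) (rateFactor g γ y') :=
    (theta_pow_le_rateFactor hη hL hγ (hlen y).1 (hlen y).2).trans (le_max_left _ _)
  have hA : 0 ≤ B₀ * pref4 (g.len y) n * Real.exp (-(δ₀ * g.dist y y')) :=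
    mul_nonneg (mul_nonneg hB hpref) (Real.exp_pos _).le
  exact mul_le_mul_of_nonneg_right (mul_le_mul_of_nonneg_left hfac hA) (hnorm lam)

end Literature.MathematicalPhysics.QuantumFieldTheory.Balaban1983to89.T4EtaRate
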